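import Summits.Ventures.PercRepro.C041RelaxedTriangleCone

/-!
# THE TWO-EXIT CYCLE BY ARC TYPES — the arc-type model of `Θ_{C_m}`, its exact reduction to the triangle, the
triangle with two (1,1)-marked vertices IN THE CONE, and the reduction of the cone form to pure inputs
(mine-3, gen 59; C-041.md §21 (a), (m), (r), (u))

A cycle `a = x₀, …, x_m = a` through the anchor with exits `x_i`, `x_j` (zones `w`, `w′`) splits into three ARCS:
`A₁` (`a` to `x_i`), `A₂` (between the exits), `A₃` (`x_j` to `a`).  The statuses of the exits depend only on the TYPE of
each arc — all blue (`Arc.b`), all red (`Arc.r`), mixed (`Arc.x`) — and an arc of length `ℓ` is mixed in `2^ℓ − 2` ways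
(`p`, `q`, `s` below).  `x_i` is MERGED iff `A₁ = b` or `A₂ = A₃ = b`, REACHED iff `A₁ = r` or `A₂ = A₃ = r` (likewise
`x_j` with `A₁ ↔ A₃`); two separated exits share one blue sub-zone iff `A₂ = b`.  A merged unreached exit contributes
`thB w`, a merged reached one `w`, a separated reached one `thR w`, a separated unreached one `n(w) • 1`, and a shared
sub-zone the JOINT vector `jointVec A I` (`A` = its admissible count, `I` = its invalid count, which depends on which
exits are reached: `jInvL` / `jInvR` / `kInv (w * w′)` / `A`).  `cycCol` lists the 27 cases, `thetaCyc p q s w w′` is the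
weighted sum.  THE REDUCTION (`thetaCyc_eq`, C-041.md §21 (a), exact): `thetaCyc p q s w w′ = thetaTri w w′ +
p • ℓψ(ℓψ(w) * w′) + s • ℓψ(w * ℓψ(w′)) + ps (n n′ + A) • 1 + q • (ℓψ(w) + pn • 1) * (ℓψ(w′) + sn′ • 1)`.
THE (1,1)-VERTEX CERTIFICATE (`thetaTri_X11_X11`): `θ_△(X(1,1), X(1,1)) = 12·X(1,1) + 6·v 1 + 6·v 0 + 2·1`, an exact
integer certificate of cone membership with VALID type states at both exits (`α = 2 ≠ β = 0`), hence every two-exit cycle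
with two (1,1)-marked vertices lies in the cone (`InCone_thetaCyc_X11_X11`).  THE CONE FORM REDUCES TO PURE INPUTS
(`InCone_thetaTri_of_pure`, `InCone_thetaCyc_of_pure`).  The (P)-theorems for the cycle with cone inputs and the closure
of the relaxed domain are in `C041CycleRelaxed` (they need `C041RelaxedTriangleMain`).  The dictionary «the arc-type model
is the cycle's six-vector» is C-041.md §20 (d) / §21 (a) (paper-level, as `triCol` for the triangle).
-/

namespace PercRepro

namespace RelaxedTriangle

open TreeClosure

/-! ## The two-exit cycle by arc types -/

/-- The type of an arc of the cycle: all blue, all red, or mixed. -/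
inductive Arc
  | b
  | r
  | x

/-- The joint vector of one blue sub-zone holding both exits: `a` admissible states, `i` invalid ones. -/
def jointVec (a i : ℝ) : Vec6 := ![a, a, a, i, i, i]

/-- The invalid states of the shared sub-zone when only the first exit is reached: `M₁L₁′ + M₂L₂′ − M₀L₀′`. -/
def jInvL (w w' : Vec6) : ℝ := w 4 * w' 1 + w 5 * w' 2 - w 3 * w' 0

/-- The invalid states of the shared sub-zone when only the second exit is reached: `L₁M₁′ + L₂M₂′ − L₀M₀′`. -/
def jInvR (w w' : Vec6) : ℝ := w 1 * w' 4 + w 2 * w' 5 - w 0 * w' 3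

/-- The contribution of the hanging zones for one triple of arc types `(A₁, A₂, A₃)` (C-041.md §20 (d), §21 (a)). -/
def cycCol (w w' : Vec6) : Arc → Arc → Arc → Vec6
  | .b, .b, .b => thB w * thB w'
  | .b, .b, .r => thB w * w'
  | .b, .b, .x => thB w * thB w'
  | .b, .r, .b => thB w * thB w'
  | .b, .r, .r => w * thR w'
  | .b, .r, .x => thB w * nAdm w' • (1 : Vec6)
  | .b, .x, .b => thB w * thB w'
  | .b, .x, .r => thB w * thR w'
  | .b, .x, .x => thB w * nAdm w' • (1 : Vec6)
  | .r, .b, .b => w * thB w'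
  | .r, .b, .r => jointVec (nAdm (w * w')) (kInv (w * w'))
  | .r, .b, .x => jointVec (nAdm (w * w')) (jInvL w w')
  | .r, .r, .b => thR w * w'
  | .r, .r, .r => thR w * thR w'
  | .r, .r, .x => thR w * thR w'
  | .r, .x, .b => thR w * thB w'
  | .r, .x, .r => thR w * thR w'
  | .r, .x, .x => thR w * nAdm w' • (1 : Vec6)
  | .x, .b, .b => thB w * thB w'
  | .x, .b, .r => jointVec (nAdm (w * w')) (jInvR w w')
  | .x, .b, .x => jointVec (nAdm (w * w')) (nAdm (w * w'))
  | .x, .r, .b => nAdm w • (1 : Vec6) * thB w'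
  | .x, .r, .r => thR w * thR w'
  | .x, .r, .x => nAdm w • (1 : Vec6) * nAdm w' • (1 : Vec6)
  | .x, .x, .b => nAdm w • (1 : Vec6) * thB w'
  | .x, .x, .r => nAdm w • (1 : Vec6) * thR w'
  | .x, .x, .x => nAdm w • (1 : Vec6) * nAdm w' • (1 : Vec6)

/-- The multiplicity of an arc type: `1` for a pure arc, `c` (`= 2^ℓ − 2` for an arc of length `ℓ`) for a mixed one. -/
def multArc (c : ℝ) : Arc → ℝ
  | .b => 1
  | .r => 1
  | .x => c

/-- One weighted term of the cycle map. -/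
def cycTerm (p q s : ℝ) (w w' : Vec6) (a1 a2 a3 : Arc) : Vec6 :=
  (multArc p a1 * multArc q a2 * multArc s a3) • cycCol w w' a1 a2 a3

/-- **The cycle map** `Θ_{C}(w, w′)` with mixed-arc multiplicities `p, q, s`: the sum over the 27 arc-type triples. -/
def thetaCyc (p q s : ℝ) (w w' : Vec6) : Vec6 :=
    cycTerm p q s w w' .b .b .b
    + cycTerm p q s w w' .b .b .r
    + cycTerm p q s w w' .b .b .x
    + cycTerm p q s w w' .b .r .b
    + cycTerm p q s w w' .b .r .r
    + cycTerm p q s w w' .b .r .x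
    + cycTerm p q s w w' .b .x .b
    + cycTerm p q s w w' .b .x .r
    + cycTerm p q s w w' .b .x .x
    + cycTerm p q s w w' .r .b .b
    + cycTerm p q s w w' .r .b .r
    + cycTerm p q s w w' .r .b .x
    + cycTerm p q s w w' .r .r .b
    + cycTerm p q s w w' .r .r .r
    + cycTerm p q s w w' .r .r .x
    + cycTerm p q s w w' .r .x .b
    + cycTerm p q s w w' .r .x .r
    + cycTerm p q s w w' .r .x .x
    + cycTerm p q s w w' .x .b .b
    + cycTerm p q s w w' .x .b .r
    + cycTerm p q s w w' .x .b .x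
    + cycTerm p q s w w' .x .r .b
    + cycTerm p q s w w' .x .r .r
    + cycTerm p q s w w' .x .r .x
    + cycTerm p q s w w' .x .x .b
    + cycTerm p q s w w' .x .x .r
    + cycTerm p q s w w' .x .x .x

/-- **THE CYCLE REDUCES TO THE TRIANGLE** (C-041.md §21 (a)): `Θ_C = Θ_△ + p ℓψ(ℓψ(w) w′) + s ℓψ(w ℓψ(w′)) +
ps (nn′ + A) 1 + q (ℓψ(w) + pn 1)(ℓψ(w′) + sn′ 1)`, `A = n(w w′)`. -/
theorem thetaCyc_eq (p q s : ℝ) (w w' : Vec6) :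
    thetaCyc p q s w w' = thetaTri w w' + p • ellv (ellv w * w') + s • ellv (w * ellv w')
      + (p * s * (nAdm w * nAdm w' + nAdm (w * w'))) • (1 : Vec6)
      + q • ((ellv w + (p * nAdm w) • (1 : Vec6)) * (ellv w' + (s * nAdm w') • (1 : Vec6))) := by
  ext i
  simp only [thetaCyc, cycTerm, cycCol, multArc, thetaTri_eq_sum, jointVec, jInvL, jInvR, Pi.add_apply,
    Pi.mul_apply, Pi.smul_apply, Pi.one_apply, smul_eq_mul, thB, thR, ellv, ell, nAdm, kInv]
  fin_cases i <;> simp <;> ring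

/-- `ℓ(ψ X)` is a cone member for every cone member `X` (the one-child closure). -/
theorem InCone_ellv {X : Vec6} (hX : InCone X) : InCone (ellv X) := by
  have := InCone_one.mul_ell (K4v_of_InCone hX)
  simpa [ellv] using this

/-- The admissible count `n = F + T₁ + T₂` of a zone satisfying (P) is non-negative. -/
theorem nAdm_nonneg_of_K4v {w : Vec6} (h : K4v w) : 0 ≤ nAdm w := by
  unfold K4v at h
  obtain ⟨h1, h2, h3, h4, _⟩ := h
  unfold nAdm
  linarith

/-! ## The triangle with two (1,1)-marked vertices is IN THE CONE — an explicit integer certificate -/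

/-- **THE (1,1)-VERTEX CERTIFICATE**: `θ_△(X(1,1), X(1,1)) = 12·X(1,1) + 6·v 1 + 6·v 0 + 2·1` (`X(1,1) = v 1 * v 0` the
(1,1)-marked vertex; exact). The mixed-type defect does not vanish here (`α = 2`, `β = 0`), so this is the first cone
membership of the triangle with VALID type states at both exits (C-041.md §21 (d), (u)). -/
theorem thetaTri_X11_X11 :
    thetaTri (v 1 * v 0) (v 1 * v 0) = (12 : ℝ) • (v 1 * v 0) + (6 : ℝ) • v 1 + (6 : ℝ) • v 0 + (2 : ℝ) • (1 : Vec6) := by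
  ext i
  simp only [thetaTri_eq_vec, Pi.add_apply, Pi.smul_apply, Pi.mul_apply, Pi.one_apply, smul_eq_mul, v]
  fin_cases i <;> simp <;> norm_num

/-- The (1,1)-marked vertex lies in the cone. -/
theorem InCone_X11 : InCone (v 1 * v 0) :=
  (InCone_v 1 ⟨zero_le_one, le_rfl⟩).mul (InCone_v 0 ⟨le_rfl, zero_le_one⟩)

/-- **THEOREM (TRIANGLE WITH TWO (1,1)-VERTICES, cone form)**: `θ_△(X(1,1), X(1,1))` lies in the cone. -/
theorem InCone_thetaTri_X11_X11 : InCone (thetaTri (v 1 * v 0) (v 1 * v 0)) := by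
  rw [thetaTri_X11_X11]
  exact (((InCone.smul 12 (by norm_num) InCone_X11).add
    (InCone.smul 6 (by norm_num) (InCone_v 1 ⟨zero_le_one, le_rfl⟩))).add
    (InCone.smul 6 (by norm_num) (InCone_v 0 ⟨le_rfl, zero_le_one⟩))).add (InCone.smul 2 (by norm_num) InCone_one)

/-- **Every two-exit cycle with two (1,1)-marked vertices lies in the cone** (on the arc-type model): the triangle part by
the certificate, every other part a cone member. -/
theorem InCone_thetaCyc_X11_X11 {p q s : ℝ} (hp : 0 ≤ p) (hq : 0 ≤ q) (hs : 0 ≤ s) :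
    InCone (thetaCyc p q s (v 1 * v 0) (v 1 * v 0)) := by
  rw [thetaCyc_eq]
  have hw : InCone (v 1 * v 0) := InCone_X11
  have hn : 0 ≤ nAdm (v 1 * v 0) := nAdm_nonneg_of_K4v (K4v_of_InCone hw)
  have hnn : 0 ≤ nAdm (v 1 * v 0 * (v 1 * v 0)) := nAdm_nonneg_of_K4v (K4v_of_InCone (hw.mul hw))
  refine (((InCone_thetaTri_X11_X11.add (InCone.smul _ hp (InCone_ellv ((InCone_ellv hw).mul hw)))).add
    (InCone.smul _ hs (InCone_ellv (hw.mul (InCone_ellv hw))))).add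
    (InCone.smul _ (mul_nonneg (mul_nonneg hp hs) (add_nonneg (mul_nonneg hn hn) hnn)) InCone_one)).add
    (InCone.smul _ hq (((InCone_ellv hw).add (InCone.smul _ (mul_nonneg hp hn) InCone_one)).mul
      ((InCone_ellv hw).add (InCone.smul _ (mul_nonneg hs hn) InCone_one))))

/-! ## The cone form of the triangle reduces to pure inputs -/

/-- **The cone conjecture for the triangle reduces to PURE inputs**: if `θ_△(V a, V b)` lies in the cone for all pure
roots, it lies in the cone for all cone members (bilinearity; C-041.md §21 (d) isolates exactly this hypothesis). -/
theorem InCone_thetaTri_of_pure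
    (H : ∀ {m m' : ℕ} (a : Fin m → ℝ) (b : Fin m' → ℝ), (∀ i, 0 ≤ a i ∧ a i ≤ 1) → (∀ j, 0 ≤ b j ∧ b j ≤ 1) →
      InCone (thetaTri (V a) (V b)))
    {w w' : Vec6} (hw : InCone w) (hw' : InCone w') : InCone (thetaTri w w') := by
  induction hw' with
  | pure b hb =>
    induction hw with
    | pure a ha => exact H a b ha hb
    | add _ _ ihx ihy => rw [thetaTri_add_left]; exact ihx.add ihy
    | smul c hc _ ih => rw [thetaTri_smul_left]; exact ih.smul c hc
  | add _ _ ihx ihy => rw [thetaTri_add_right]; exact ihx.add ihy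
  | smul c hc _ ih => rw [thetaTri_smul_right]; exact ih.smul c hc

/-- Under the same hypothesis every two-exit cycle with cone-member exits lies in the cone. -/
theorem InCone_thetaCyc_of_pure
    (H : ∀ {m m' : ℕ} (a : Fin m → ℝ) (b : Fin m' → ℝ), (∀ i, 0 ≤ a i ∧ a i ≤ 1) → (∀ j, 0 ≤ b j ∧ b j ≤ 1) →
      InCone (thetaTri (V a) (V b)))
    {w w' : Vec6} (hw : InCone w) (hw' : InCone w') {p q s : ℝ} (hp : 0 ≤ p) (hq : 0 ≤ q) (hs : 0 ≤ s) :
    InCone (thetaCyc p q s w w') := by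
  rw [thetaCyc_eq]
  have hn : 0 ≤ nAdm w := nAdm_nonneg_of_K4v (K4v_of_InCone hw)
  have hn' : 0 ≤ nAdm w' := nAdm_nonneg_of_K4v (K4v_of_InCone hw')
  have hnn : 0 ≤ nAdm (w * w') := nAdm_nonneg_of_K4v (K4v_of_InCone (hw.mul hw'))
  refine ((((InCone_thetaTri_of_pure H hw hw').add (InCone.smul _ hp (InCone_ellv ((InCone_ellv hw).mul hw')))).add
    (InCone.smul _ hs (InCone_ellv (hw.mul (InCone_ellv hw'))))).add
    (InCone.smul _ (mul_nonneg (mul_nonneg hp hs) (add_nonneg (mul_nonneg hn hn') hnn)) InCone_one)).add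
    (InCone.smul _ hq (((InCone_ellv hw).add (InCone.smul _ (mul_nonneg hp hn) InCone_one)).mul
      ((InCone_ellv hw').add (InCone.smul _ (mul_nonneg hs hn') InCone_one))))

end RelaxedTriangle

end PercRepro
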